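import Summits.CriticalPhenomena.CardyFormulaZ2.Theorems.CardySusyWardParafermionFamiliesToSLESixHalfCRLayerPairing

/-!
# The half-CR vertex relation on the wired layer (stub `stub_halfCRLayer`, part 2: assembly)

Helper file for the crux `CardySusyWard.ParafermionFamiliesToSLESix` (stmt-CriticalPhenomena-10814),
line `strip-anchored-vertex-normalisation` (skeleton r4), registered sub-goal `stub_halfCRLayer` of
`stub_momentIdentity`.

**Theorem** (`S2.halfCRLayer_of_holeFree`, registered one-line form `stub_halfCRLayer`).  For
`ℤ²`-admissible Dobrushin data `E` whose set of inner faces is hole-free, every RANDOM medial vertex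
`p` with both faces inner — an edge `e` of `Ω_δ` NOT an `A`–`A` edge, with NO endpoint on the arc
`B`, both of whose faces are inner (`IsRandomMV` of the Defs module; this contains the interior
vertices `IsInteriorMV` of the landed `S2.halfCRVertexRelation_of_holeFree` AND the layer of edges
`{x, a}` from an interior site to a site of the wired arc `A`) — and every reading mesh `δ > 0`:
`G(NW) - G(SE) = i · (G(NE) - G(SW))`, `G = cornerObs E δ` at the four corners of `p`
(Duminil-Copin 2012, Prop. 4 / Duminil-Copin–Smirnov 2012, Prop. 8.6 at `q = 1`, `σ = 1/3`, at ALL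
vertices of the medial domain where the turn is random).

Proof: that of `S2.halfCRVertexRelation_of_holeFree`, line by line — pair `ω` with `ω △ {e}`
(measure-preserving since `e` is random: not `A`–`A`, off `B`), the half-CR combination of the four
corner integrands is `S2.gval` along the exploration, and `gval` is odd under the flip — with the
pathwise oddness now `S2.gval_add_gval_toggle_free`, which asks only that the two faces OF `e` be
inner (parts 1′–2′ of `…HalfCRLayerPairing.lean`: `loopTurn_eq_free`, `gval_case1_free`, over the
tree's `cornerOrbit_toggle_case1_free`), instead of all eight faces at its endpoints.
-/

noncomputable section

namespace Summit.CriticalPhenomena.CardyFormulaZ2.Theorems.ParafermionFamiliesToSLESix.StripAnchored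

open MeasureTheory Finset Complex
open scoped symmDiff
open Literature.Probability.Percolation (bondPercolation half BondConfig)
open Literature.Probability.LatticeModels
open Literature.Probability.LatticeModels.DiscreteDobrushin (startCorner exitTime isStartCorner_startCorner
  medialExploration_eq_explorationList not_isInnerFace_exitTime isInnerFace_of_lt_exitTime)
open Literature.Barriers.CriticalPhenomena (medialCornersAt medialVertexOf HalfCRRelationAt)
open Summit.CriticalPhenomena.CardyFormulaZ2.Cruxes.EdgePrecompact.QkzStripBoundaryArm (cornerObs)

namespace S2

variable {D : DiscreteDobrushin}

/-! ## Pathwise oddness under the flip, weak hypotheses -/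

-- adapted from `S2.gval_add_of_one` (…HalfCRVertexRelationPathwise.lean): `hx`, `hy` weakened to the two faces of `e`
/-- **Exactly one arriving corner on the side of `ω`, weak hypotheses.** If `p` is a dart of the
exploration of `ω` (before the exit) and its partner is not, then `g(ω) + g(ω') = 0` for every `ω'`
whose completion is that of `ω` toggled at `e = cTgt p` (hole-free inner faces; the two faces of
`e` inner, no endpoint of `e` on the arc `B`). [cite: DuminilCopin2012Parafermion, Proposition 4] -/
theorem gval_add_of_one_free (hD : D.IsZdAdmissible) (hH : HoleFree {f : Site 2 | D.IsInnerFace f})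
    {p : Site 2 × Fin 4} (hpf : D.IsInnerFace (cFace p)) (hp₂f : D.IsInnerFace (cFace (cornerPartner p)))
    (hB : ∀ x ∈ cTgt p, x ∉ D.zdArcB) {ω ω' : BondConfig (Site 2)}
    (hagree : ∀ e, e ≠ cTgt p → (e ∈ D.bcBondConfig ω' ↔ e ∈ D.bcBondConfig ω))
    (hdiff : ¬ (cTgt p ∈ D.bcBondConfig ω' ↔ cTgt p ∈ D.bcBondConfig ω))
    (h₁ : ∃ i < exitTime hD ω, cornerOrbit (D.bcBondConfig ω) (startCorner hD) i = p)
    (h₂ : ∀ i < exitTime hD ω, cornerOrbit (D.bcBondConfig ω) (startCorner hD) i ≠ cornerPartner p) :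
    gval (D.bcBondConfig ω) (startCorner hD) p (exitTime hD ω) +
      gval (D.bcBondConfig ω') (startCorner hD) p (exitTime hD ω') = 0 := by
  set c₀ := startCorner hD with hc₀def
  have hc₀ : D.IsStartCorner c₀ := isStartCorner_startCorner hD
  set β := D.bcBondConfig ω with hβ
  set β' := D.bcBondConfig ω' with hβ'
  set N := exitTime hD ω with hNdef
  have hN : ¬ D.IsInnerFace (cFace (cornerOrbit β c₀ N)) := not_isInnerFace_exitTime hD _
  have hlt : ∀ k < N, D.IsInnerFace (cFace (cornerOrbit β c₀ k)) := fun k hk => isInnerFace_of_lt_exitTime hD _ hk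
  obtain ⟨i₁, hi₁N, hi₁⟩ := h₁
  have hpf' : D.IsInnerFace (faceAt p.1 (p.2 + 1)) := by rw [← cFace_cornerPartner]; exact hp₂f
  have hpB : p.1 + cornerUnit (p.2 + 1) ∉ D.zdArcB := hB _ (Sym2.mem_mk_right _ _)
  -- period data of the interface cycle and of the loop of the partner
  have hc₀m : c₀.1 ∈ meshDomain D.Ω D.δ := D.zdBoundary_subset_meshDomain (D.zdArcA_subset_zdBoundary hc₀.mem_zdArcA)
  obtain ⟨P, hP0, hP, hPmin⟩ := exists_min_period hD ω hc₀m
  have hym : (cornerPartner p).1 ∈ meshDomain D.Ω D.δ := fst_mem_meshDomain_of_isInnerFace hp₂f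
  obtain ⟨Q, hQ0, hQ, hQmin⟩ := exists_min_period hD ω hym
  -- the loop is inner and off the interface (only the face of the partner is needed)
  have hdisj : ∀ m s, cornerOrbit β (cornerPartner p) m ≠ cornerOrbit β c₀ s := by
    intro m s h
    obtain ⟨s', hs'⟩ := exists_eq_cornerOrbit_of_iterate hP0 hP m h
    have hin : D.IsInnerFace (cFace (cornerOrbit β c₀ s')) := hs' ▸ hp₂f
    rw [isInnerFace_cornerOrbit_iff hD hc₀ hN hlt hP0 hP hPmin] at hin
    exact h₂ _ hin (by rw [cornerOrbit_mod_period hP]; exact hs'.symm)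
  obtain ⟨-, hloop, -, hin', hout'⟩ := cornerOrbit_toggle_case1_free hD hc₀ hagree hdiff hpf hp₂f hpB hN hlt hP0 hP
    hPmin hQ0 hQ hQmin hi₁ hi₁N h₂
  have hLin : ∀ m, D.IsInnerFace (cFace (cornerOrbit β (cornerPartner p) m)) := by
    intro m
    rw [← cornerOrbit_mod_period hQ m]
    rcases Nat.eq_zero_or_pos (m % Q) with h0 | hpos
    · rw [h0]; exact hp₂f
    · have hmQ : m % Q < Q := Nat.mod_lt _ hQ0
      have := hloop (m % Q - 1) (by omega)
      rw [Nat.sub_add_cancel hpos] at this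
      rw [← this]
      exact hin' _ (by omega)
  -- orientation of the loop, and the pair identity
  have hS := loopTurn_eq_free hH hc₀ hpf hpf' hN hQ0 hQ hQmin hLin (fun m i _ => hdisj m i) hi₁ hi₁N
  have hpair := gval_case1_free hD hc₀ hagree hdiff hB hpf hp₂f hN hlt hP0 hP hPmin hQ0 hQ hQmin hi₁ hi₁N h₂ hS
  rwa [← exitTime_eq_of hD ω' hout' hin'] at hpair

-- adapted from `S2.gval_add_gval_toggle` (…HalfCRVertexRelationPathwise.lean): `hx`, `hy` weakened to the two faces of `e`
/-- **The half-CR combination is odd under toggling `e`, weak hypotheses.** For admissible Dobrushin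
data with hole-free inner faces, an edge `e = cTgt p` both of whose FACES are inner and with no
endpoint on the arc `B`, and configurations `ω`, `ω'` whose completions agree off `e` and differ at
`e`: `g(ω) + g(ω') = 0` (`g` = `S2.gval` along the exploration, from the start corner to the exit).
[cite: DuminilCopin2012Parafermion, Proposition 4] [cite: DuminilCopinSmirnov2012Lattice, Proposition 8.6] -/
theorem gval_add_gval_toggle_free (hD : D.IsZdAdmissible) (hH : HoleFree {f : Site 2 | D.IsInnerFace f})
    {p : Site 2 × Fin 4} (hpf : D.IsInnerFace (cFace p)) (hp₂f : D.IsInnerFace (cFace (cornerPartner p)))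
    (hB : ∀ x ∈ cTgt p, x ∉ D.zdArcB) {ω ω' : BondConfig (Site 2)}
    (hagree : ∀ e, e ≠ cTgt p → (e ∈ D.bcBondConfig ω' ↔ e ∈ D.bcBondConfig ω))
    (hdiff : ¬ (cTgt p ∈ D.bcBondConfig ω' ↔ cTgt p ∈ D.bcBondConfig ω)) :
    gval (D.bcBondConfig ω) (startCorner hD) p (exitTime hD ω) +
      gval (D.bcBondConfig ω') (startCorner hD) p (exitTime hD ω') = 0 := by
  set c₀ := startCorner hD with hc₀def
  have hc₀ : D.IsStartCorner c₀ := isStartCorner_startCorner hD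
  set N := exitTime hD ω with hNdef
  have hN : ¬ D.IsInnerFace (cFace (cornerOrbit (D.bcBondConfig ω) c₀ N)) := not_isInnerFace_exitTime hD _
  have hlt : ∀ k < N, D.IsInnerFace (cFace (cornerOrbit (D.bcBondConfig ω) c₀ k)) := fun k hk =>
    isInnerFace_of_lt_exitTime hD _ hk
  -- the symmetric forms of the hypotheses (swap `ω ↔ ω'`, `p ↔ p₂`)
  have hagree' : ∀ e, e ≠ cTgt p → (e ∈ D.bcBondConfig ω ↔ e ∈ D.bcBondConfig ω') := fun e he => (hagree e he).symm
  have hdiff' : ¬ (cTgt p ∈ D.bcBondConfig ω ↔ cTgt p ∈ D.bcBondConfig ω') := fun h => hdiff h.symm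
  have hpf₂ : D.IsInnerFace (cFace (cornerPartner (cornerPartner p))) := by rw [partner_partner]; exact hpf
  have hB₂ : ∀ x ∈ cTgt (cornerPartner p), x ∉ D.zdArcB := by rw [cTgt_partner]; exact hB
  have hagree₂ : ∀ e, e ≠ cTgt (cornerPartner p) → (e ∈ D.bcBondConfig ω' ↔ e ∈ D.bcBondConfig ω) := by
    rw [cTgt_partner]; exact hagree
  have hdiff₂ : ¬ (cTgt (cornerPartner p) ∈ D.bcBondConfig ω' ↔ cTgt (cornerPartner p) ∈ D.bcBondConfig ω) := by
    rw [cTgt_partner]; exact hdiff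
  have hagree₂' : ∀ e, e ≠ cTgt (cornerPartner p) → (e ∈ D.bcBondConfig ω ↔ e ∈ D.bcBondConfig ω') :=
    fun e he => (hagree₂ e he).symm
  have hdiff₂' : ¬ (cTgt (cornerPartner p) ∈ D.bcBondConfig ω ↔ cTgt (cornerPartner p) ∈ D.bcBondConfig ω') :=
    fun h => hdiff₂ h.symm
  by_cases h₁ : ∃ i < N, cornerOrbit (D.bcBondConfig ω) c₀ i = p
  · by_cases h₂ : ∃ i < N, cornerOrbit (D.bcBondConfig ω) c₀ i = cornerPartner p
    · -- both arrive in `ω`: exactly one arrives in `ω'`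
      obtain ⟨i₁, hi₁N, hi₁⟩ := h₁
      obtain ⟨i₂, hi₂N, hi₂⟩ := h₂
      have hne : i₁ ≠ i₂ := by rintro rfl; exact partner_ne p (hi₂.symm.trans hi₁)
      rcases Nat.lt_or_gt_of_ne hne with h12 | h12
      · obtain ⟨h₁', h₂'⟩ := one_of_both hD hagree hdiff hi₁ hi₂ h12 hi₂N
        have := gval_add_of_one_free hD hH hpf hp₂f hB hagree' hdiff' h₁' h₂'
        linear_combination this
      · obtain ⟨h₁', h₂'⟩ := one_of_both (p := cornerPartner p) hD hagree₂ hdiff₂ hi₂ (by rw [partner_partner]; exact hi₁)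
          h12 hi₁N
        rw [partner_partner] at h₂'
        have := gval_add_of_one_free hD hH hp₂f hpf₂ hB₂ hagree₂' hdiff₂' h₁' (by rw [partner_partner]; exact h₂')
        rw [gval_partner, gval_partner] at this
        linear_combination -this
    · -- only `p` arrives
      push Not at h₂
      exact gval_add_of_one_free hD hH hpf hp₂f hB hagree hdiff h₁ h₂
  · push Not at h₁
    by_cases h₂ : ∃ i < N, cornerOrbit (D.bcBondConfig ω) c₀ i = cornerPartner p
    · -- only the partner arrives
      have := gval_add_of_one_free (p := cornerPartner p) hD hH hp₂f hpf₂ hB₂ hagree₂ hdiff₂ h₂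
        (by rw [partner_partner]; exact h₁)
      rw [gval_partner, gval_partner] at this
      linear_combination -this
    · -- no arrival: the explorations agree
      push Not at h₂
      have hcase := cornerOrbit_toggle_case0 (c₀ := c₀) hagree hdiff h₁ h₂
      have hN' : exitTime hD ω' = N := by
        refine exitTime_eq_of hD _ ?_ fun k hk => ?_
        · rw [hcase N le_rfl]; exact hN
        · rw [hcase k hk.le]; exact hlt k hk
      rw [hN', gval_case0 hc₀ hB h₁ h₂, gval_case0 (ω := ω') hc₀ hB (fun i hi => by rw [hcase i hi.le]; exact h₁ i hi)
        (fun i hi => by rw [hcase i hi.le]; exact h₂ i hi), add_zero]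

/-! ## The theorem -/

-- adapted from `S2.halfCRVertexRelation_of_holeFree` (…HalfCRVertexRelation.lean): arc hypothesis weakened to "random"
/-- **The half Cauchy–Riemann vertex relation at `q = 1`, `σ = 1/3`, at every random medial vertex**
(Duminil-Copin 2012, Prop. 4; Duminil-Copin–Smirnov 2012, Prop. 8.6), for `ℤ²`-admissible Dobrushin
data with HOLE-FREE inner faces: at every medial vertex `p` that is an edge of `Ω_δ`, not an
`A`–`A` edge, with no endpoint on the arc `B` and both faces inner, and every reading mesh `δ > 0`,
`G(NW) - G(SE) = i (G(NE) - G(SW))` for `G = cornerObs E δ` at the corners `medialCornersAt`.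
[cite: DuminilCopin2012Parafermion, Proposition 4] [cite: DuminilCopinSmirnov2012Lattice, Proposition 8.6] -/
theorem halfCRLayer_of_holeFree (E : DiscreteDobrushin) (hE : E.IsZdAdmissible)
    (hH : HoleFree {f : Site 2 | E.IsInnerFace f}) (p : Site 2 × Fin 2)
    (he : medialVertexOf p ∈ (discreteDomainGraph E.Ω E.δ).edgeSet)
    (hA : ¬ (∀ x ∈ medialVertexOf p, x ∈ E.zdArcA)) (hB : ∀ x ∈ medialVertexOf p, x ∉ E.zdArcB)
    (hf : ∀ f : Site 2, IsCorner p.1 f → IsCorner (p.1 + Pi.single p.2 1) f → E.IsInnerFace f)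
    (δ : ℝ) (hδ : 0 < δ) :
    HalfCRRelationAt I (fun c : Site 2 × Site 2 => cornerObs E δ c.1 c.2) p := by
  classical
  set q := baseCorner p with hqdef
  set e := medialVertexOf p with hedef
  have hq : cTgt q = e := cTgt_baseCorner p
  set c₀ := startCorner hE with hc₀def
  set P := bondPercolation (zdGraph 2) half with hPdef
  -- the data at `e`: no endpoint on `B`, both faces inner
  have hBq : ∀ x ∈ cTgt q, x ∉ E.zdArcB := by rw [hq]; exact hB
  have hfar : p.1 + Pi.single p.2 1 = q.1 + cornerUnit (q.2 + 1) := fst_add_single_eq p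
  have hfq : E.IsInnerFace (cFace q) := by
    refine hf _ (isCorner_cFace q) ?_
    rw [hfar]
    exact (isCorner_add_faceAt_iff q.1 (q.2 + 1) q.2).2 (Or.inr (fin4_add_one_add_three q.2).symm)
  have hfq₂ : E.IsInnerFace (cFace (cornerPartner q)) := by
    rw [cFace_cornerPartner]
    refine hf _ (isCorner_faceAt q.1 _) ?_
    rw [hfar]
    exact (isCorner_add_faceAt_iff q.1 (q.2 + 1) (q.2 + 1)).2 (Or.inl rfl)
  -- toggling `e` toggles the completed configuration at `e` only (`e` is random)
  have hez : e ∈ (zdGraph 2).edgeSet := by rw [← hq]; exact cTgt_mem_edgeSet q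
  have htog : ∀ ω : BondConfig (Site 2),
      (∀ e', e' ≠ cTgt q → (e' ∈ E.bcBondConfig (ω ∆ {e}) ↔ e' ∈ E.bcBondConfig ω)) ∧
      ¬ (cTgt q ∈ E.bcBondConfig (ω ∆ {e}) ↔ cTgt q ∈ E.bcBondConfig ω) := by
    intro ω
    refine ⟨fun e' he' => ?_, fun h => ?_⟩
    · simp only [DiscreteDobrushin.mem_bcBondConfig_iff, Set.mem_symmDiff, Set.mem_singleton_iff, hq] at he' ⊢
      tauto
    · rw [hq] at h
      simp only [DiscreteDobrushin.mem_bcBondConfig_iff, Set.mem_symmDiff, Set.mem_singleton_iff,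
        not_true, and_false, true_and, false_or] at h
      tauto
  -- the integrands
  set Φ : Fin 4 → List MedialVertex → ℂ := fun k γ => cornerIntegrand δ (medialCornersAt p.1 p.2 k).1 (medialCornersAt p.1 p.2 k).2 γ
    with hΦ
  have hΦW : ∀ (ω : BondConfig (Site 2)) (k : Fin 4), Φ k (medialExploration E ω) =
      dartW (E.bcBondConfig ω) c₀ (codedCornerAt p k) (exitTime hE ω) := by
    intro ω k
    simp only [hΦ]
    rw [medialExploration_eq_explorationList hE ω]
    exact cornerIntegrand_explorationList hδ.ne' _ _ _ (codedCornerAt_spec p k).1 (codedCornerAt_spec p k).2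
  set Ψ : List MedialVertex → ℂ := fun γ => Φ 0 γ - Φ 2 γ - I * (Φ 1 γ - Φ 3 γ) with hΨ
  have hΨg : ∀ ω : BondConfig (Site 2), Ψ (medialExploration E ω) =
      ![(1 : ℂ), I] p.2 * gval (E.bcBondConfig ω) c₀ q (exitTime hE ω) := by
    intro ω
    show Φ 0 _ - Φ 2 _ - I * (Φ 1 _ - Φ 3 _) = _
    have hc := comb_codedCornerAt p (fun r => dartW (E.bcBondConfig ω) c₀ r (exitTime hE ω))
    rw [hΦW, hΦW, hΦW, hΦW, hc, hqdef]
    rfl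
  -- oddness under the flip
  have hodd : ∀ ω : BondConfig (Site 2), Ψ (medialExploration E (ω ∆ {e})) = -Ψ (medialExploration E ω) := by
    intro ω
    obtain ⟨hagree, hdiff⟩ := htog ω
    have h := gval_add_gval_toggle_free hE hH hfq hfq₂ hBq hagree hdiff
    rw [hΨg, hΨg, eq_neg_iff_add_eq_zero, ← mul_add, add_comm, h, mul_zero]
  -- the integral of `Ψ ∘ exploration` vanishes
  have hJ : ∫ ω, Ψ (medialExploration E ω) ∂P = 0 := by
    have h1 : ∫ ω, Ψ (medialExploration E (ω ∆ {e})) ∂P = ∫ ω, Ψ (medialExploration E ω) ∂P :=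
      Summit.CriticalPhenomena.CardyFormulaZ2.Cruxes.ParafermionPrecompact.KenyonStreamSecondRelation.integral_comp_symmDiff_singleton
        hez (fun ω => Ψ (medialExploration E ω))
    simp_rw [hodd, integral_neg] at h1
    linear_combination -(h1 / 2)
  -- linearity
  have hint : ∀ k, Integrable (fun ω => Φ k (medialExploration E ω)) P := fun k =>
    S1.integrable_comp_medialExploration' hE (Φ k)
  have hG : ∀ k, cornerObs E δ (medialCornersAt p.1 p.2 k).1 (medialCornersAt p.1 p.2 k).2 =
      ∫ ω, Φ k (medialExploration E ω) ∂P := fun k => cornerObs_eq_integral E δ _ _ -- buildfix 2026-08-20: was `rfl` (two `winding` copies)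
  have e1 : ∫ ω, (Φ 0 (medialExploration E ω) - Φ 2 (medialExploration E ω) -
      I * (Φ 1 (medialExploration E ω) - Φ 3 (medialExploration E ω))) ∂P =
      (∫ ω, (Φ 0 (medialExploration E ω) - Φ 2 (medialExploration E ω)) ∂P) -
        ∫ ω, I * (Φ 1 (medialExploration E ω) - Φ 3 (medialExploration E ω)) ∂P :=
    integral_sub ((hint 0).sub (hint 2)) (((hint 1).sub (hint 3)).const_mul I)
  have e2 : ∫ ω, (Φ 0 (medialExploration E ω) - Φ 2 (medialExploration E ω)) ∂P =
      (∫ ω, Φ 0 (medialExploration E ω) ∂P) - ∫ ω, Φ 2 (medialExploration E ω) ∂P := integral_sub (hint 0) (hint 2)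
  have e3 : ∫ ω, I * (Φ 1 (medialExploration E ω) - Φ 3 (medialExploration E ω)) ∂P =
      I * ∫ ω, (Φ 1 (medialExploration E ω) - Φ 3 (medialExploration E ω)) ∂P := integral_const_mul _ _
  have e4 : ∫ ω, (Φ 1 (medialExploration E ω) - Φ 3 (medialExploration E ω)) ∂P =
      (∫ ω, Φ 1 (medialExploration E ω) ∂P) - ∫ ω, Φ 3 (medialExploration E ω) ∂P := integral_sub (hint 1) (hint 3)
  simp only [hΨ] at hJ
  rw [e1, e2, e3, e4] at hJ
  unfold HalfCRRelationAt
  simp only [hG]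
  linear_combination hJ

/-- **The relation at every random vertex of a discretised Dobrushin (Jordan) domain** — the form the
line consumes (`IsFamily D Λ` gives `(Λ δ).Ω = D.carrier`, whose inner faces are hole-free by
`holeFree_innerFaces`), over the Defs vocabulary `IsRandomMV`. [cite: DuminilCopin2012Parafermion, Proposition 4] -/
theorem halfCRLayer_of_dobrushinDomain (D : Literature.Probability.RandomPlanarGeometry.DobrushinDomain)
    (E : DiscreteDobrushin) (hΩ : E.Ω = D.carrier) (hE : E.IsZdAdmissible) (p : Site 2 × Fin 2)
    (hp : IsRandomMV E p) (δ : ℝ) (hδ : 0 < δ) :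
    HalfCRRelationAt Complex.I (fun c : Site 2 × Site 2 => cornerObs E δ c.1 c.2) p :=
  halfCRLayer_of_holeFree E hE (holeFree_innerFaces D.toJordanDomain hΩ hE.delta_pos) p hp.1 hp.2.1 hp.2.2.1
    hp.2.2.2 δ hδ

/-- Interior medial vertices (`IsInteriorMV`: no endpoint on either arc) are random (`IsRandomMV`):
the landed interior relation `halfCRVertexRelation_of_holeFree` is a special case. [folklore] -/
theorem isRandomMV_of_isInteriorMV {E : DiscreteDobrushin} {p : Site 2 × Fin 2} (hp : IsInteriorMV E p) :
    IsRandomMV E p :=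
  ⟨hp.1, fun h => (hp.2.1 _ (Sym2.mem_mk_left _ _)).1 (h _ (Sym2.mem_mk_left _ _)), fun x hx => (hp.2.1 x hx).2, hp.2.2⟩

end S2

/-- **Registered one-line form** (sub-goal `stub_halfCRLayer` of stmt-CriticalPhenomena-10814, skeleton r4,
sub-goal of `stub_momentIdentity`): the half-CR vertex relation with `χ = i` at every RANDOM
both-faces-inner medial vertex (`IsRandomMV` unfolded) of `ℤ²`-admissible Dobrushin data with
hole-free inner faces. [cite: DuminilCopin2012Parafermion, Proposition 4] -/
theorem stub_halfCRLayer : ∀ (E : DiscreteDobrushin), E.IsZdAdmissible → HoleFree {f : Site 2 | E.IsInnerFace f} → ∀ p : Site 2 × Fin 2, (medialVertexOf p ∈ (discreteDomainGraph E.Ω E.δ).edgeSet ∧ ¬ (∀ x ∈ medialVertexOf p, x ∈ E.zdArcA) ∧ (∀ x ∈ medialVertexOf p, x ∉ E.zdArcB) ∧ ∀ f : Site 2, IsCorner p.1 f → IsCorner (p.1 + Pi.single p.2 1) f → E.IsInnerFace f) → ∀ δ : ℝ, 0 < δ → HalfCRRelationAt Complex.I (fun c : Site 2 × Site 2 =>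 cornerObs E δ c.1 c.2) p :=
  fun E hE hH p hp δ hδ => S2.halfCRLayer_of_holeFree E hE hH p hp.1 hp.2.1 hp.2.2.1 hp.2.2.2 δ hδ

/-- **The relation over the line's vocabulary** (`IsRandomMV` of the Defs module).
[cite: DuminilCopin2012Parafermion, Proposition 4] -/
theorem halfCRVertexRelation_of_isRandomMV (E : DiscreteDobrushin) (hE : E.IsZdAdmissible)
    (hH : HoleFree {f : Site 2 | E.IsInnerFace f}) (p : Site 2 × Fin 2) (hp : IsRandomMV E p) (δ : ℝ) (hδ : 0 < δ) :
    HalfCRRelationAt Complex.I (fun c : Site 2 × Site 2 => cornerObs E δ c.1 c.2) p :=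
  stub_halfCRLayer E hE hH p hp δ hδ

end Summit.CriticalPhenomena.CardyFormulaZ2.Theorems.ParafermionFamiliesToSLESix.StripAnchored

end
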